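import Summits.CriticalPhenomena.PercolationContinuityZ3.Theses.PercNonProliferation
import Literature.Probability.Percolation.PlanarDuality

/-!
# Sketch — crux `NonProliferation` (stmt-CriticalPhenomena-4444), crux-ideate round 2, ideator 5

Typed first lemmas / transfer targets of the two idea cards

* `boundary-pinning`            — `cell_pigeonhole`, `cellUnionBound`, `BoundaryCellTwoArm`,
                                   `BoundaryCellTwoArmExp`, `nonProliferation_of_boundaryCellTwoArm`;
* `independent-copy-screening`  — `independentCopyBound`, `IndependentScreening`,
                                   `nonProliferation_of_independentScreening`;
* support (provable now, for the lead): `PowerCap` (E N_n ≤ C n^{2-α} from the DKT uniqueness zone).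

Statements only (`sorry` = to be proved by the line); everything elaborates over tree declarations.
-/

noncomputable section

namespace Summit.CriticalPhenomena.PercolationContinuityZ3.Cruxes.NonProliferation.IdeateR2K5

open MeasureTheory Filter Topology
open Literature.Probability.LatticeModels Literature.Probability.Percolation
open Summit.CriticalPhenomena.PercolationContinuityZ3.Theses.PercNonProliferation

/-- The critical bond measure on `ℤ³`. -/
abbrev μ : Measure (BondConfig (Site 3)) := bondPercolation (zdGraph 3) (criticalProbI 3)

/-- The big box `B(2n)` as a vertex set. -/
abbrev B2 (n : ℕ) : Set (Site 3) := ↑(box 3 (2 * n))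

/-- The inner vertex boundary `∂⁻B(2n)` (the FREE outer boundary of the crux's box). -/
abbrev bd (n : ℕ) : Finset (Site 3) := innerBoundary (zdGraph 3) (box 3 (2 * n))

/-- `N_n ≥ k` through representatives: `k` points of `B(n)`, each joined inside `B(2n)` to `∂⁻B(2n)`,
pairwise NOT joined inside `B(2n)`.  `atLeast (M+1) n` is literally the complement of the crux's event. -/
def atLeast (k n : ℕ) : Set (BondConfig (Site 3)) :=
  {ω | ∃ x : Fin k → Site 3, (∀ i, x i ∈ box 3 n) ∧
    (∀ i, ∃ y ∈ bd n, ω ∈ openConnIn (B2 n) (x i) y) ∧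
    ∀ i j, i ≠ j → ω ∉ openConnIn (B2 n) (x i) (x j)}

/-- The crux is `∃ M c, 0 < c ∧ ∃ᶠ n, c ≤ P((atLeast (M+1) n)ᶜ)` — definitionally. -/
theorem nonProliferation_iff :
    NonProliferation ↔ ∃ (M : ℕ) (c : ℝ), 0 < c ∧ ∃ᶠ n : ℕ in atTop, c ≤ μ.real (atLeast (M + 1) n)ᶜ :=
  Iff.rfl

/-! ## Card `boundary-pinning` -/

/-- **Boundary two-DISTINCT-cluster event at a cell `Q ⊆ ∂⁻B(2n)`**: two points `u, v ∈ Q`, each joined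
inside `B(2n)` to the inner box `B(n)` (distance `≥ n` away), NOT joined to each other inside `B(2n)`
(two box-distinct crossers touch the same boundary cell). -/
def faceTwoArm (n : ℕ) (Q : Finset (Site 3)) : Set (BondConfig (Site 3)) :=
  {ω | ∃ u ∈ Q, ∃ v ∈ Q, (∃ a ∈ box 3 n, ω ∈ openConnIn (B2 n) u a) ∧
    (∃ b ∈ box 3 n, ω ∈ openConnIn (B2 n) v b) ∧ ω ∉ openConnIn (B2 n) u v}

/-- **First lemma, deterministic part (pigeonhole).** If a finite family `𝒬` of cells covers the free
boundary `∂⁻B(2n)` and there are `|𝒬| + 1` box-distinct crossers, two of them touch the same cell: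
the boundary two-distinct-cluster event holds at some `Q ∈ 𝒬`.  [provable now: representatives
`x_i ↔ y_i ∈ ∂⁻B(2n)`; pigeonhole on `i ↦` a cell containing `y_i`; symmetry/transitivity of `openConnIn`] -/
theorem cell_pigeonhole (n : ℕ) (𝒬 : Finset (Finset (Site 3)))
    (hcov : ∀ y ∈ bd n, ∃ Q ∈ 𝒬, y ∈ Q) (ω : BondConfig (Site 3))
    (h : ω ∈ atLeast (𝒬.card + 1) n) : ∃ Q ∈ 𝒬, ω ∈ faceTwoArm n Q := by
  classical
  obtain ⟨x, hx, hconn, hdisj⟩ := h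
  choose y hy hxy using hconn
  choose Q hQ hyQ using fun i => hcov (y i) (hy i)
  -- pigeonhole: `|𝒬| + 1` indices, `|𝒬|` cells
  obtain ⟨i, j, hij, hQij⟩ : ∃ i j : Fin (𝒬.card + 1), i ≠ j ∧ Q i = Q j := by
    have hlt : Fintype.card (𝒬 : Set (Finset (Site 3))) < Fintype.card (Fin (𝒬.card + 1)) := by
      simp
    obtain ⟨i, j, hij, h⟩ :=
      Fintype.exists_ne_map_eq_of_card_lt (fun i => (⟨Q i, hQ i⟩ : (𝒬 : Set (Finset (Site 3))))) hlt
    exact ⟨i, j, hij, congrArg Subtype.val h⟩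
  have hsymm : ∀ {a b : Site 3}, ω ∈ openConnIn (B2 n) a b → ω ∈ openConnIn (B2 n) b a :=
    fun ⟨ha, hb, hab⟩ => ⟨hb, ha, hab.symm⟩
  have htrans : ∀ {a b c : Site 3}, ω ∈ openConnIn (B2 n) a b → ω ∈ openConnIn (B2 n) b c →
      ω ∈ openConnIn (B2 n) a c :=
    fun ⟨ha, _, hab⟩ ⟨_, hc, hbc⟩ => ⟨ha, hc, hab.trans hbc⟩
  refine ⟨Q i, hQ i, y i, hyQ i, y j, hQij ▸ hyQ j, ⟨x i, hx i, hsymm (hxy i)⟩,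
    ⟨x j, hx j, hsymm (hxy j)⟩, ?_⟩
  intro hyy
  exact hdisj i j hij (htrans (htrans (hxy i) hyy) (hsymm (hxy j)))

/-- **First lemma, probabilistic form (union bound).** -/
theorem cellUnionBound (n : ℕ) (𝒬 : Finset (Finset (Site 3))) (hcov : ∀ y ∈ bd n, ∃ Q ∈ 𝒬, y ∈ Q) :
    μ.real (atLeast (𝒬.card + 1) n) ≤ ∑ Q ∈ 𝒬, μ.real (faceTwoArm n Q) := by
  calc μ.real (atLeast (𝒬.card + 1) n) ≤ μ.real (⋃ Q ∈ 𝒬, faceTwoArm n Q) := by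
        refine measureReal_mono (fun ω hω => ?_) (measure_ne_top _ _)
        obtain ⟨Q, hQ, h⟩ := cell_pigeonhole n 𝒬 hcov ω hω
        exact Set.mem_biUnion hQ h
    _ ≤ ∑ Q ∈ 𝒬, μ.real (faceTwoArm n Q) := measureReal_biUnion_finset_le _ _

/-- **Transfer target `C⁺` (exponent-free form).** For some `ε ∈ (0,1]` and all large `n`, every cell of the
free boundary of sup-diameter `≤ ε n` carries the boundary two-distinct-cluster event with probability
`≤ ε² / 500` (so that the `≤ 216/ε²` cells of a grid of mesh `⌊εn⌋` have union probability `< 1/2`). -/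
def BoundaryCellTwoArm : Prop :=
  ∃ ε : ℝ, 0 < ε ∧ ε ≤ 1 ∧ ∃ n₀ : ℕ, ∀ n : ℕ, n₀ ≤ n → ∀ Q : Finset (Site 3), Q ⊆ bd n →
    (∀ u ∈ Q, ∀ v ∈ Q, ∀ i : Fin 3, |((u i - v i : ℤ) : ℝ)| ≤ ε * n) →
      500 * μ.real (faceTwoArm n Q) ≤ ε ^ 2

/-- **Transfer target, exponent form** (the natural scale-covariant statement): the boundary
two-distinct-cluster event from a cell of diameter `r` to depth `n` decays like `(r/n)^a` with
`a > 2 = dim ∂B`.  Predicted `a = d = 3` (boundary stress-tensor dimension; MC of crux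
stmt-CriticalPhenomena-0911: `a₂ = 3.0 ± 0.1` at the wall vs `1.86` in the bulk). -/
def BoundaryCellTwoArmExp : Prop :=
  ∃ a C : ℝ, 2 < a ∧ ∀ n : ℕ, 1 ≤ n → ∀ r : ℕ, 1 ≤ r → r ≤ n → ∀ Q : Finset (Site 3), Q ⊆ bd n →
    (∀ u ∈ Q, ∀ v ∈ Q, ∀ i : Fin 3, |u i - v i| ≤ (r : ℤ)) →
      μ.real (faceTwoArm n Q) ≤ C * ((r : ℝ) / n) ^ a

/-- Exponent form ⇒ exponent-free form (`ε := min 1 (500 C)^{-1/(a-2)}`-type choice, `r := ⌊εn⌋`). -/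
theorem boundaryCellTwoArm_of_exp : BoundaryCellTwoArmExp → BoundaryCellTwoArm := by
  sorry

/-- **The line**: `cellUnionBound` (provable) + `BoundaryCellTwoArm` (open, d = 3) ⇒ the crux, even in the
EVENTUAL form with `c = 1/2`, `M = ⌈216/ε²⌉`. -/
theorem nonProliferation_of_boundaryCellTwoArm (h : BoundaryCellTwoArm) : NonProliferation := by
  sorry

/-! ## Card `independent-copy-screening` -/

/-- The vertex set of the open cluster of `x` in the graph induced on `B(2n)`. -/
def clusterIn (n : ℕ) (ω : BondConfig (Site 3)) (x : Site 3) : Set (Site 3) :=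
  {v | ω ∈ openConnIn (B2 n) x v}

/-- **Avoidance by an independent copy**: `p.1` has `k` box-distinct crossers with representatives
`x_i`, and the INDEPENDENT configuration `p.2` has an open crossing of the annulus inside `B(2n)` that
avoids every vertex of those `k` clusters. -/
def avoidSet (k n : ℕ) : Set (BondConfig (Site 3) × BondConfig (Site 3)) :=
  {p | ∃ x : Fin k → Site 3, (∀ i, x i ∈ box 3 n) ∧
    (∀ i, ∃ y ∈ bd n, p.1 ∈ openConnIn (B2 n) (x i) y) ∧
    (∀ i j, i ≠ j → p.1 ∉ openConnIn (B2 n) (x i) (x j)) ∧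
    ∃ a ∈ box 3 n, ∃ b ∈ bd n,
      p.2 ∈ openConnIn (B2 n \ ⋃ i, clusterIn n p.1 (x i)) a b}

/-- **First lemma (exploration renewal + Fubini).** `P(N_n ≥ k+1) ≤ (P ⊗ P)(avoidSet k n)`: explore the
clusters of the vertices of `B(n)` in lexicographic order up to the `k`-th crosser (a stopping set with
closed revealed boundary); a `(k+1)`-st crosser is an open crossing of the UNREVEALED residual domain, whose
conditional law is a fresh `P_{p_c}` (strong Markov property of cluster exploration, tree:
`ClusterExploration`, `StoppingSetDecoupling`); the residual domain is contained in the complement of the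
`k` explored crossers; Fubini.  (`k = 0`: equality `P(N ≥ 1) = P(cross)`.)  [provable now, size L] -/
theorem independentCopyBound (k n : ℕ) :
    μ.real (atLeast (k + 1) n) ≤ (μ.prod μ).real (avoidSet k n) := by
  sorry

/-- **Transfer target `C⁺`: independent-copy screening beyond `k₀` crossers.** Along a subsequence of
scales, for every `k ≥ k₀`: an independent critical configuration crosses the annulus in the complement
of `k` crossers of the first configuration with probability at most `(1-δ)·P(N ≥ k)`.
(d = 3 enters as `d_f + 1/ν > d`: an independent critical sponge meets the red bonds of a fresh
crosser; false above six dimensions, where `4 + 2 ≤ d`.) -/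
def IndependentScreening : Prop :=
  ∃ (k₀ : ℕ) (δ : ℝ), 0 < δ ∧ ∃ᶠ n : ℕ in atTop, ∀ k : ℕ, k₀ ≤ k →
    (μ.prod μ).real (avoidSet k n) ≤ (1 - δ) * μ.real (atLeast k n)

/-- **The line**: `independentCopyBound` (provable) + `IndependentScreening` (open, d = 3) ⇒ geometric
tail `P(N ≥ k₀ + j) ≤ (1-δ)^j` along the subsequence ⇒ the crux with `M = k₀ + ⌈log 2/δ⌉`, `c = 1/2`. -/
theorem nonProliferation_of_independentScreening (h : IndependentScreening) : NonProliferation := by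
  sorry

/-! ## Support for the lead (provable now): a power-saving cap on `E N_n` -/

/-- **`E_{p_c} N_n ≤ C n^{2-α}`** with `α = α(3) > 0` of the in-tree DKT uniqueness-zone bound
(`Literature.Probability.Percolation.dkt_prop1`): cells of side `⌊(n/2)^α⌋` on the INNER sphere `∂B(n)`
(every crosser meets it), `N_n ≤ #cells + Σ_cells |cell|·1{two box-distinct crossers through the cell}`,
and two such crossers violate `uniqZoneAt z ⌊m^α⌋ m` (`m = n/2`, `z + Λ_m ⊆ B(2n)`).  Improves the route
file's unconditional cap `E N_n = o(n²)` (BGN).  Here `E N_n = Σ_{k<|B(n)|} P(N_n ≥ k+1)`. -/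
def PowerCap : Prop :=
  ∃ α C : ℝ, 0 < α ∧ ∀ n : ℕ, 1 ≤ n →
    ∑ k ∈ Finset.range (box 3 n).card, μ.real (atLeast (k + 1) n) ≤ C * (n : ℝ) ^ (2 - α)

theorem powerCap : PowerCap := by
  sorry

end Summit.CriticalPhenomena.PercolationContinuityZ3.Cruxes.NonProliferation.IdeateR2K5

end
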